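import Literature.AnabelianGeometry.EtaleTheta.ThetaRigidity
import Literature.AnabelianGeometry.EtaleTheta.Discharge.Sec2DtpYThetaAbelianCorollaries
import HarnessLib

/-!
# [EtTh] Prop. 2.12 (i) — the PROFINITE case `Δ_* = Δ_X̲̲` (sub-DAG row P212-L01, «not typed cases»)

S. Mochizuki, *The étale theta function and its Frobenioid-theoretic manifestations*, Publ. RIMS **45**
(2009), Prop. 2.12 (i), PRIMS PDF p. 45 (printed 271): «we have an inclusion
`Ker(Δ^Θ_* ↠ Δ^ell_*) = l·Δ_Θ ⊆ [Δ^Θ_*, Δ^Θ_*]` of subgroups of `Δ^Θ_*`» for `Δ_*` ranging over the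
TEMPERED groups `Δ^tp_X̲̲, Δ^tp_C̲` and the PROFINITE groups `Δ_X̲̲, Δ_C̲` (the orbicurve `Ċ` of the
printed list is STRUCK by the author's erratum, Comments (v) / [IUTchI] Rmk 3.1.6)
[cite: MochizukiEtTh2009, Prop 2.12(i) p.45]. Cell abc-iut, layer L2; sub-DAG
`plan/L2/SUBDAG-EtTh-Prop212-Lem217.md` (holder abc-iut-w5-d238) row P212-L01; ROW #3 ruled to seat
abc-iut-w5-d234 (gen 2) by abc-iut-L2-lead (2026-08-26T03:14:46Z).

The tree types Prop. 2.12 (i) for `Δ_* = Δ^tp_X̲̲` only: abc-iut-L2-t2's `RigidData.Prop212_i`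
(`ThetaRigidity.lean`, FROZEN) — `l·Δ̃_Θ ≤ ⁅Ker aug, Ker aug⁆ ⊔ thetaKer` pulled back to `Π^tp_X̲̲` — proved
abstractly from the commutator structure (abc-iut-L2-t10 `prop212_i_of_hcomm`) and at the §1 model
modulo `{IsEtThOrigin, hYcl}` (`DoubleUnderline.rigidData_prop212_i_of_origin`). This file TYPES and
DERIVES the remaining printed case that is reachable over the `RigidData` interface:

* (a) **the profinite case `Δ_* = Δ_X̲̲`** — `RigidData.Prop212_i_hat R ι` for a homomorphism
  `ι : Π^tp_X̲̲ → P̂` into a topological group (at the model: the profinite completion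
  `Π^tp_X ↪ Π_X` of the §1 setting, [SemiAnbd] §6 p. 69 «the `∧` denotes the profinite completion, or,
  equivalently, the closure in `Π`»; `Δ_X̲̲ := (ι Δ^tp_X̲̲)⁻`): «`l·Δ_Θ ⊆ [Δ^Θ_X̲̲, Δ^Θ_X̲̲]⁻`» pulled back
  to `P̂`, i.e. `(ι l·Δ̃_Θ)⁻ ≤ (⁅(ι Ker aug)⁻, (ι Ker aug)⁻⁆ ⊔ ι thetaKer)⁻` — with the CLOSED bracket.
  TODO(general form): print's bracket in the profinite group is the abstract commutator subgroup; it
  equals the closed one because `Δ^Θ_X̲̲` is topologically finitely generated (class-two theta group),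
  a property the `RigidData` interface does not record — so the closed form is what is typed.
  PROVED: `prop212_i_map` (the image form `ι(l·Δ̃_Θ) ≤ ⁅ι Δ^tp, ι Δ^tp⁆ ⊔ ι thetaKer`, functoriality
  of `⁅·,·⁆` and `⊔` under `Subgroup.map`) and **`prop212_i_hat_of_prop212_i : R.Prop212_i →
  R.Prop212_i_hat ι`** (monotonicity + minimality of the topological closure; neither continuity nor
  density of `ι` is needed for this direction — print's «image/closure of the tempered inclusion»);
  at the §1 model **`DoubleUnderline.rigidData_prop212_i_hat_of_origin`** with `ι := toHat|_{Π^tp_X̲̲}`,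
  modulo the same `{IsEtThOrigin, hYcl}` as the tempered case (hYcl = GAP-LEDGER G-w4d021-2).
* (b) **the K-core case `Δ_* = Δ^tp_C̲`** is NOT reachable over `RigidData`/`ThetaEnvData`: that
  interface (abc-iut-L2-t2) carries `Π^tp_X̲̲ ⊇ Π^tp_Y ⊇ Π^tp_Ÿ` and the theta quotient of `Π^tp_X̲̲` but NO
  object for `Π^tp_C ⊇ Π^tp_C̲ ⊇ Π^tp_X̲̲` nor a theta quotient at the `C`-level; the `C`-level groups live in
  `ThetaCovers.TemperedCoverData` (Def. 2.5 covers; under repair S1–S3, F1 rider), which has no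
  `Δ^Θ_C`/`thetaKer` at the `C̲`-level and no adapter to `RigidData`. Missing name, for the record:
  a Θ-kernel `TemperedCoverData.thetaKerCu ≤ Π^tp_C̲` with `thetaKerCu ⊓ Π^tp_X̲̲ = RigidData.thetaKer`
  under a `RigidData ↔ CoverData` adapter (W3-L2-02). No consumer in the tree (Cor. 2.18/2.19 use
  `* = X` only, per the erratum), hence no GAP-LEDGER row.

v2 (append-only): (b′) **the K-core case as a MONOTONE IMAGE** — what IS reachable without a `C`-level
object: for ANY overgroup `j : Π^tp_X̲̲ → P_c` together with subgroups `Δ_c ⊇ j(Δ^tp_X̲̲)` («`Δ^tp_C̲ ⊇ Δ^tp_X̲̲`»)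
and `K_c ⊇ j(thetaKer)` («the theta kernel of `Π^tp_C̲` restricts to that of `Π^tp_X̲̲`», p. 45 l.5–43: the
`Θ`/`ell` quotients of the `C`-objects are DEFINED through `Ker(Δ_X ↠ Δ^Θ_X)`), the inclusion
`j(l·Δ̃_Θ) ≤ ⁅Δ_c, Δ_c⁆ ⊔ K_c` — `RigidData.Prop212_i_core`, PROVED from `Prop212_i` by monotonicity
(`prop212_i_core_of_prop212_i`), and its profinite-closure form `Prop212_i_core_hat` /
`prop212_i_core_hat_of_prop212_i` (case `Δ_C̲` of the printed list). At the genuine `Π^tp_C̲` (once the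
tree has it, with `K_c ⊓ Π^tp_X̲̲ = thetaKer`) these ARE print's `C̲`-cases read through `X̲̲`'s `l·Δ_Θ`; what
they do NOT contain is print's separate identification `Ker(Δ^Θ_C̲ ↠ Δ^ell_C̲) = l·Δ_Θ` on the `C̲` side
(definitional in print, p. 45; needs the `C`-level object — recorded in (b) above).

PROOF-ONLY apart from the one sub-DAG statement `Prop212_i_hat` (a `def … : Prop`, parametrised —
the typed profinite CASE of a printed statement, not a new fact: it is PROVED here from `Prop212_i`).
(v2: likewise `Prop212_i_core`, `Prop212_i_core_hat` — typed cases, each PROVED here from `Prop212_i`.)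
HONEST FRAMING: [EtTh] is refereed and undisputed; typed ≠ proved for the interface-level `Prop212_i`
itself (a named fact, F-1920, model-proved modulo `IsEtThOrigin` + `hYcl`); nothing here bears on the
disputed [IUTchIII] Cor. 3.12.
-/

noncomputable section

namespace Literature.AnabelianGeometry.EtaleTheta

open Literature.AnabelianGeometry.SemiGraphs

universe u

namespace RigidData

variable {N : ℕ+} {l : ℕ} (R : RigidData.{u} N l)

/-- **[EtTh] Prop. 2.12 (i), profinite case `Δ_* = Δ_X̲̲`** (p. 45), over a homomorphism
`ι : Π^tp_X̲̲ → P̂` into a topological group (the profinite completion `Π^tp_X̲̲ ↪ Π_X̲̲`, [SemiAnbd] §6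
p. 69): with `Δ_X̲̲ := (ι Δ^tp_X̲̲)⁻` («closure in `Π`»), the pull-back to `P̂` of
«`l·Δ_Θ ⊆ [Δ^Θ_X̲̲, Δ^Θ_X̲̲]`» with the closed bracket:
`(ι l·Δ̃_Θ)⁻ ≤ (⁅Δ_X̲̲, Δ_X̲̲⁆ ⊔ ι Ker(Π^tp_X̲̲ ↠ (Π^tp_X̲̲)^Θ))⁻`. TODO(general form): the abstract
(non-closed) commutator subgroup of the profinite `Δ^Θ_X̲̲` — equal to the closed one by topological
finite generation, not recorded on the interface. [cite: MochizukiEtTh2009, Prop 2.12(i) p.45] -/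
def Prop212_i_hat {Ph : Type*} [Group Ph] [TopologicalSpace Ph] [IsTopologicalGroup Ph]
    (ι : R.PiX →* Ph) : Prop :=
  (R.lDeltaTheta.map ι).topologicalClosure ≤
    (⁅(R.aug.ker.map ι).topologicalClosure, (R.aug.ker.map ι).topologicalClosure⁆ ⊔
      R.thetaKer.map ι).topologicalClosure

/-- **Image form** of Prop. 2.12 (i) under any homomorphism `ι` out of `Π^tp_X̲̲`:
`ι(l·Δ̃_Θ) ≤ ⁅ι Δ^tp_X̲̲, ι Δ^tp_X̲̲⁆ ⊔ ι thetaKer` (`Subgroup.map` preserves `⊔` and `⁅·,·⁆`).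
[cite: MochizukiEtTh2009, Prop 2.12(i) p.45] -/
theorem prop212_i_map (h : R.Prop212_i) {P : Type*} [Group P] (ι : R.PiX →* P) :
    R.lDeltaTheta.map ι ≤ ⁅R.aug.ker.map ι, R.aug.ker.map ι⁆ ⊔ R.thetaKer.map ι := by
  have h' := Subgroup.map_mono (f := ι) h
  rwa [Subgroup.map_sup, Subgroup.map_commutator] at h'

/-- **[EtTh] Prop. 2.12 (i): the profinite case follows from the tempered one** — «the image/closure
of the tempered inclusion» (p. 45, cases `Δ_X̲̲` of the printed list): `Prop212_i R → Prop212_i_hat R ι`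
for EVERY homomorphism `ι` into a topological group (no continuity or density hypothesis is needed in
this direction). [cite: MochizukiEtTh2009, Prop 2.12(i) p.45] -/
theorem prop212_i_hat_of_prop212_i (h : R.Prop212_i) {Ph : Type*} [Group Ph] [TopologicalSpace Ph]
    [IsTopologicalGroup Ph] (ι : R.PiX →* Ph) : R.Prop212_i_hat ι := by
  unfold Prop212_i_hat
  refine Subgroup.topologicalClosure_minimal _ ?_ (Subgroup.isClosed_topologicalClosure _)
  refine (R.prop212_i_map h ι).trans (le_trans ?_ (Subgroup.le_topologicalClosure _))
  exact sup_le_sup_right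
    (Subgroup.commutator_mono (Subgroup.le_topologicalClosure _) (Subgroup.le_topologicalClosure _)) _

/-- The closure `Δ_X̲̲ := (ι Δ^tp_X̲̲)⁻` contains `ι Δ^tp_X̲̲`; recorded for consumers reading `Prop212_i_hat`
against print's `Δ_X̲̲`. [cite: MochizukiSemiAnbd2006, §6 p.69] -/
theorem map_aug_ker_le_closure {Ph : Type*} [Group Ph] [TopologicalSpace Ph] [IsTopologicalGroup Ph]
    (ι : R.PiX →* Ph) : R.aug.ker.map ι ≤ (R.aug.ker.map ι).topologicalClosure :=
  Subgroup.le_topologicalClosure _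

end RigidData

/-! ### The §1 model: `ι := ` the profinite completion `Π^tp_X ↪ Π_X` restricted to `Π^tp_X̲̲` -/

namespace ThetaSetting.EtaleThetaData.DoubleUnderline

variable {p : ℕ} [Fact p.Prime] {D : ThetaSetting p} {E : D.EtaleThetaData} {l : ℕ}
  (C : E.DoubleUnderline l) {N : ℕ+} (μ : D.CyclotomeMod l N)

/-- The profinite completion `Π^tp_X ↪ Π_X` of the §1 setting restricted to `Π^tp_X̲̲ = C.Huu` — the `ι`
of the profinite case at the model (its image has closure `Π_X̲̲ ⊆ Π_X`).
[cite: MochizukiSemiAnbd2006, §6 p.69] -/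
abbrev toHatHuu : ↥C.Huu →* D.PiHat := D.toHat.toMonoidHom.comp C.Huu.subtype

/-- **[EtTh] Prop. 2.12 (i), profinite case `Δ_* = Δ_X̲̲`, for the §1 model** (abc-iut-L2-t8's `rigidData`
over the double cover `X̲̲`), modulo `IsEtThOrigin` and `hYcl` exactly as the tempered case
(`rigidData_prop212_i_of_origin`, abc-iut-L2-d1/t10), with `ι := toHat|_{Π^tp_X̲̲}` into the profinite
completion `Π_X`. [cite: MochizukiEtTh2009, Prop 2.12(i) p.45] -/
theorem rigidData_prop212_i_hat_of_origin (hC : D.Compat) (hS : D.Sec2Hyps) (h15 : Prop15iii E hC)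
    (L : C.CuspLabels) (hO : D.IsEtThOrigin)
    (hYcl : (D.DtpY.map D.toHat.toMonoidHom).topologicalClosure ≤
      D.DtpY.map D.toHat.toMonoidHom ⊔ (⁅⁅D.DeltaHat, D.DeltaHat⁆, D.DeltaHat⁆).topologicalClosure) :
    (C.rigidData μ hC hS h15 L).Prop212_i_hat C.toHatHuu :=
  (C.rigidData μ hC hS h15 L).prop212_i_hat_of_prop212_i
    (C.rigidData_prop212_i_of_origin μ hC hS h15 L hO hYcl) C.toHatHuu

end ThetaSetting.EtaleThetaData.DoubleUnderline

/-! ### v2: the K-core cases `Δ^tp_C̲`, `Δ_C̲` as monotone images of the `X̲̲` case -/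

namespace RigidData

variable {N : ℕ+} {l : ℕ} (R : RigidData.{u} N l)

/-- **[EtTh] Prop. 2.12 (i), K-core case `Δ_* = Δ^tp_C̲`, as reachable over `RigidData`** (p. 45): for an
overgroup `j : Π^tp_X̲̲ → P_c` («`Π^tp_X̲̲ ⊆ Π^tp_C̲`»), a subgroup `Δ_c` of `P_c` containing `j(Δ^tp_X̲̲)`
(«`Δ^tp_C̲`») and a subgroup `K_c` containing `j(thetaKer)` («`Ker(Π^tp_C̲ ↠ (Π^tp_C̲)^Θ)`», the `Θ`-quotient
of the `C`-objects being defined through `Ker(Δ_X ↠ Δ^Θ_X)`, p. 45): `j(l·Δ̃_Θ) ≤ ⁅Δ_c, Δ_c⁆ ⊔ K_c`, i.e.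
«`l·Δ_Θ ⊆ [Δ^Θ_C̲, Δ^Θ_C̲]`» pulled back to `P_c`, with `l·Δ_Θ` read through `X̲̲`. TODO(general form):
print's own `C̲`-side identification `Ker(Δ^Θ_C̲ ↠ Δ^ell_C̲) = l·Δ_Θ` needs a `C`-level object the
interface lacks. [cite: MochizukiEtTh2009, Prop 2.12(i) p.45] -/
def Prop212_i_core {Pc : Type*} [Group Pc] (j : R.PiX →* Pc) (Δc Kc : Subgroup Pc) : Prop :=
  R.lDeltaTheta.map j ≤ ⁅Δc, Δc⁆ ⊔ Kc

/-- **The K-core case follows from the `X̲̲` case by monotonicity** («in the case of `X̲̲, C̲` … follows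
similarly», p. 45): `Prop212_i R → Prop212_i_core R j Δ_c K_c` whenever `j(Δ^tp_X̲̲) ≤ Δ_c` and
`j(thetaKer) ≤ K_c`. [cite: MochizukiEtTh2009, Prop 2.12(i) p.45] -/
theorem prop212_i_core_of_prop212_i (h : R.Prop212_i) {Pc : Type*} [Group Pc] (j : R.PiX →* Pc)
    {Δc Kc : Subgroup Pc} (hΔ : R.aug.ker.map j ≤ Δc) (hK : R.thetaKer.map j ≤ Kc) :
    R.Prop212_i_core j Δc Kc :=
  (R.prop212_i_map h j).trans (sup_le_sup (Subgroup.commutator_mono hΔ hΔ) hK)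

/-- **[EtTh] Prop. 2.12 (i), profinite K-core case `Δ_* = Δ_C̲`** (p. 45), over `j : Π^tp_X̲̲ → P̂_c` into a
topological group («`Π_C̲`», [SemiAnbd] §6 p. 69) with `Δ_c ⊇ j(Δ^tp_X̲̲)`, `K_c ⊇ j(thetaKer)`:
`(j l·Δ̃_Θ)⁻ ≤ (⁅Δ_c⁻, Δ_c⁻⁆ ⊔ K_c)⁻`. [cite: MochizukiEtTh2009, Prop 2.12(i) p.45] -/
def Prop212_i_core_hat {Pc : Type*} [Group Pc] [TopologicalSpace Pc] [IsTopologicalGroup Pc]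
    (j : R.PiX →* Pc) (Δc Kc : Subgroup Pc) : Prop :=
  (R.lDeltaTheta.map j).topologicalClosure ≤
    (⁅Δc.topologicalClosure, Δc.topologicalClosure⁆ ⊔ Kc).topologicalClosure

/-- The profinite K-core case follows from the `X̲̲` case (monotonicity + closure minimality).
[cite: MochizukiEtTh2009, Prop 2.12(i) p.45] -/
theorem prop212_i_core_hat_of_prop212_i (h : R.Prop212_i) {Pc : Type*} [Group Pc]
    [TopologicalSpace Pc] [IsTopologicalGroup Pc] (j : R.PiX →* Pc) {Δc Kc : Subgroup Pc}
    (hΔ : R.aug.ker.map j ≤ Δc) (hK : R.thetaKer.map j ≤ Kc) : R.Prop212_i_core_hat j Δc Kc := by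
  unfold Prop212_i_core_hat
  refine Subgroup.topologicalClosure_minimal _ ?_ (Subgroup.isClosed_topologicalClosure _)
  refine (R.prop212_i_core_of_prop212_i h j hΔ hK).trans (le_trans ?_ (Subgroup.le_topologicalClosure _))
  exact sup_le_sup_right
    (Subgroup.commutator_mono (Subgroup.le_topologicalClosure _) (Subgroup.le_topologicalClosure _)) _

/-- The `X̲̲` profinite case is the K-core profinite case at `j := ι`, `Δ_c := ι(Δ^tp_X̲̲)`, `K_c := ι(thetaKer)`
(so the two typed profinite statements are one family). [cite: MochizukiEtTh2009, Prop 2.12(i) p.45] -/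
theorem prop212_i_hat_iff_core_hat {Ph : Type*} [Group Ph] [TopologicalSpace Ph] [IsTopologicalGroup Ph]
    (ι : R.PiX →* Ph) :
    R.Prop212_i_hat ι ↔ R.Prop212_i_core_hat ι (R.aug.ker.map ι) (R.thetaKer.map ι) :=
  Iff.rfl

end RigidData

end Literature.AnabelianGeometry.EtaleTheta

end
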